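import Summits.Ventures.PercRepro.RankLevelSetLevelSixHeavyCellSq28C
import Summits.Ventures.PercRepro.TriangleCapEightI
import Summits.Ventures.PercRepro.S1TrianglePlusSharp
import Summits.Ventures.PercRepro.RankLevelSetFourCircuitNullityFour
import Summits.Ventures.PercRepro.S1FiveCircuitBase
import Summits.Ventures.PercRepro.RankLevelSetCoreSixColoopFree16
import Summits.Ventures.PercRepro.RankLevelSetLevelSixArithHeavySq26A
import Summits.Ventures.PercRepro.RankLevelSetLevelSixArithHeavySq26B
import Summits.Ventures.PercRepro.RankLevelSetLevelSixArithHeavySq26C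
import Summits.Ventures.PercRepro.RankLevelSetLevelSixArithHeavySq26D
import Summits.Ventures.PercRepro.RankLevelSetLevelSixArithHeavySq26E
import Summits.Ventures.PercRepro.RankLevelSetLevelSixArithHeavySq26F
import Summits.Ventures.PercRepro.RankLevelSetLevelSixArithHeavySq26G
import Summits.Ventures.PercRepro.RankLevelSetLevelSixArithHeavySq26H
import Summits.Ventures.PercRepro.RankLevelSetLevelSixArithHeavySq26I
import Summits.Ventures.PercRepro.RankLevelSetLevelSixArithHeavySq26J
import Summits.Ventures.PercRepro.RankLevelSetLevelSixArithHeavySq26K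
import Summits.Ventures.PercRepro.RankLevelSetLevelSixArithHeavySq26L
import Summits.Ventures.PercRepro.RankLevelSetLevelSixArithHeavySq26M

/-!
# PercRepro — THE 26 ROW, THE LOW CORANKS: THE COLOOP-FREE CELLS `(p ≥ 26, 7 ≤ d ≤ 14)` AND THE CELLS `(p ≥ 26, 15 ≤ d ≤ 31)` (p8 g7, S3)

`proofs/SUBCLAIM-S3-p8.md` §3u (THE 26 ROW, on the nullity-4 cap 16). The cells of the `26` row at `d ≤ 31` on the cell theorem `c025_core_six_heavy_cell_sq28c` (RankLevelSetLevelSixHeavyCellSq28C): at `d ≤ 14` for COLOOP-FREE cores with the caps of the coloop-free averaging step (`s4_cf_d` / `s5_cf_d`, RankLevelSetCoreSixColoopFree: `s₄ ≤ 60 / 89 / 128 / 178 / 241 / 320 / 417 / 535`, `s₅ ≤ 274 / 467 / 756 / 1170 / 1748 / 2532 / 3574 / 4932`; ratios `0.95 / 0.93 / 0.87 / 0.88 / 0.72 / 0.72 / 0.56 / 0.56`), at `15 ≤ d ≤ 31` for every core with the table caps (ratios `≤ 0.72`); the arithmetic of RankLevelSetLevelSixArithHeavySq27A … M. Axioms: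 standard.
-/

open scoped Matroid

namespace PercRepro

namespace ThmN

open Set

variable {α : Type}

/-- **The COLOOP-FREE `e`-free core at level `6`, corank `7 ≤ d ≤ 14`, rank `p ≥ 26`** (the cell theorem `c025_core_six_heavy_cell_sq28c` with the per-corank parameters of ArithHeavySq26A … D and the coloop-free caps `s4_cf16_d` / `s5_cf26_d`: the averaging step with `m = |E| ≥ 26 + d` on the chain from the nullity-4 cap 16 and p2's 5-circuit chain). -/
theorem c025_core_six_bounded_corank_heavy_sq26_free (M : Matroid α) [M.Finite] (p d : ℕ) (hp : 26 ≤ p) (hd7 : 7 ≤ d) (hd14 : d ≤ 14) (hcf : ∀ e ∈ M.E, ¬ M.IsColoop e)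
    (hR : M.eRank = (p : ℕ∞)) (hn : M.E.ncard = p + d)
    (hfree : ∀ e ∈ M.E, ∃ A ⊆ M.E \ {e}, e ∉ M.closure A ∧ e ∉ M.closure ((M.E \ {e}) \ A)) :
    RLS M p 6 := by
  have hd : M.E.encard = M.eRank + d := by
    rw [hR, ← M.ground_finite.cast_ncard_eq, hn]
    push_cast
    ring
  have hL : ∀ e ∈ M.E, ¬ M.IsLoop e := not_isLoop_of_free M hfree
  have hs : ∀ e ∈ M.E, ∀ f ∈ M.E, e ≠ f → M.eRk {e, f} = 2 := by
    intro e he f hf hef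
    have h2 : (2 : ℕ∞) ≤ M.eRk {e, f} :=
      two_le_eRk_of_two_le_ncard_of_free M hfree (pair_subset he hf) (by rw [ncard_pair hef])
    have h3 : M.eRk {e, f} ≤ 2 := by
      have := M.eRk_le_encard {e, f}
      rwa [encard_pair hef] at this
    exact le_antisymm h3 h2
  have hC1 : ∀ L ⊆ M.E, M.eRk L = 2 → L.ncard ≤ 3 :=
    fun L hL hr => ncard_le_three_of_eRk_two M hs hfree hL hr
  have hC2 : ∀ P ⊆ M.E, M.eRk P ≤ 3 → P.ncard ≤ 6 :=
    fun P hP hr => ncard_le_six_of_eRk_le_three_of_free M hfree hP hr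
  interval_cases d
  · exact c025_core_six_heavy_cell_sq28c M p 7 7 1 1 13 12 0 514592 1000 13 275 52 11
      (by norm_num) (by norm_num) (by norm_num) (by norm_num) (by norm_num) (by norm_num)
      (by norm_num [cnull]) (by norm_num [cnull]) (Or.inl (by norm_num)) (Or.inl (by norm_num)) (Or.inl (by norm_num)) (by norm_num) (by norm_num) (by norm_num)
      ((TriangleCap.core_ncard_triangles_le_cq3 M hfree hd).trans (by decide))
      (s4_cf16_7 M hfree hcf hd (by omega))
      (s5_cf26_7 M hfree hcf hd (by omega))
      (Or.inl (tail_six_heavy_sq26_7 p hp)) hR hn hfree (level_six_poly_heavy_sq26_7 p hp)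
  · exact c025_core_six_heavy_cell_sq28c M p 8 7 2 1 16 14 0 392232 1000 14 470 78 13
      (by norm_num) (by norm_num) (by norm_num) (by norm_num) (by norm_num) (by norm_num)
      (by norm_num [cnull]) (by norm_num [cnull]) (Or.inl (by norm_num)) (Or.inl (by norm_num)) (Or.inl (by norm_num)) (by norm_num) (by norm_num) (by norm_num)
      ((TriangleCap.core_ncard_triangles_le_cq3 M hfree hd).trans (by decide))
      (s4_cf16_8 M hfree hcf hd (by omega))
      (s5_cf26_8 M hfree hcf hd (by omega))
      (Or.inl (tail_six_heavy_sq26_8 p hp)) hR hn hfree (level_six_poly_heavy_sq26_8 p hp)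
  · exact c025_core_six_heavy_cell_sq28c M p 9 7 2 1 19 16 0 256715 1000 15 759 111 16
      (by norm_num) (by norm_num) (by norm_num) (by norm_num) (by norm_num) (by norm_num)
      (by norm_num [cnull]) (by norm_num [cnull]) (Or.inl (by norm_num)) (Or.inl (by norm_num)) (Or.inl (by norm_num)) (by norm_num) (by norm_num) (by norm_num)
      ((TriangleCap.core_ncard_triangles_le_cq3 M hfree hd).trans (by decide))
      (s4_cf16_9 M hfree hcf hd (by omega))
      (s5_cf26_9 M hfree hcf hd (by omega))
      (Or.inl (tail_six_heavy_sq26_9 p hp)) hR hn hfree (level_six_poly_heavy_sq26_9 p hp)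
  · exact c025_core_six_heavy_cell_sq28c M p 10 9 1 1 17 15 0 156612 1000 16 1175 155 20
      (by norm_num) (by norm_num) (by norm_num) (by norm_num) (by norm_num) (by norm_num)
      (by norm_num [cnull]) (by norm_num [cnull]) (Or.inl (by norm_num)) (Or.inr (Or.inl ⟨by norm_num, by norm_num⟩)) (Or.inl (by norm_num)) (by norm_num) (by norm_num) (by norm_num)
      ((TriangleCap.core_ncard_triangles_le_cq3 M hfree hd).trans (by decide))
      (s4_cf16_10 M hfree hcf hd (by omega))
      (s5_cf26_10 M hfree hcf hd (by omega))
      (Or.inl (tail_six_heavy_sq26_10 p hp)) hR hn hfree (level_six_poly_heavy_sq26_10 p hp)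
  · exact c025_core_six_heavy_cell_sq28c M p 11 9 1 1 19 16 0 94688 1000 17 1755 210 24
      (by norm_num) (by norm_num) (by norm_num) (by norm_num) (by norm_num) (by norm_num)
      (by norm_num [cnull]) (by norm_num [cnull]) (Or.inl (by norm_num)) (Or.inr (Or.inl ⟨by norm_num, by norm_num⟩)) (Or.inl (by norm_num)) (by norm_num) (by norm_num) (by norm_num)
      ((TriangleCap.core_ncard_triangles_le_cq3 M hfree hd).trans (by decide))
      (s4_cf16_11 M hfree hcf hd (by omega))
      (s5_cf26_11 M hfree hcf hd (by omega))
      (Or.inl (tail_six_heavy_sq26_11 p hp)) hR hn hfree (level_six_poly_heavy_sq26_11 p hp)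
  · exact c025_core_six_heavy_cell_sq28c M p 12 10 1 1 20 17 0 58158 1000 18 2542 279 29
      (by norm_num) (by norm_num) (by norm_num) (by norm_num) (by norm_num) (by norm_num)
      (by norm_num [cnull]) (by norm_num [cnull]) (Or.inl (by norm_num)) (Or.inr (Or.inl ⟨by norm_num, by norm_num⟩)) (Or.inl (by norm_num)) (by norm_num) (by norm_num) (by norm_num)
      ((TriangleCap.core_ncard_triangles_le_cq3 M hfree hd).trans (by decide))
      (s4_cf16_12 M hfree hcf hd (by omega))
      (s5_cf26_12 M hfree hcf hd (by omega))
      (Or.inl (tail_six_heavy_sq26_12 p hp)) hR hn hfree (level_six_poly_heavy_sq26_12 p hp)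
  · exact c025_core_six_heavy_cell_sq28c M p 13 10 1 1 22 18 0 37138 1000 19 3588 363 34
      (by norm_num) (by norm_num) (by norm_num) (by norm_num) (by norm_num) (by norm_num)
      (by norm_num [cnull]) (by norm_num [cnull]) (Or.inl (by norm_num)) (Or.inr (Or.inl ⟨by norm_num, by norm_num⟩)) (Or.inl (by norm_num)) (by norm_num) (by norm_num) (by norm_num)
      ((TriangleCap.core_ncard_triangles_le_cq3 M hfree hd).trans (by decide))
      (s4_cf16_13 M hfree hcf hd (by omega))
      (s5_cf26_13 M hfree hcf hd (by omega))
      (Or.inl (tail_six_heavy_sq26_13 p hp)) hR hn hfree (level_six_poly_heavy_sq26_13 p hp)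
  · exact c025_core_six_heavy_cell_sq28c M p 14 11 1 1 23 19 0 24636 1000 20 4949 465 40
      (by norm_num) (by norm_num) (by norm_num) (by norm_num) (by norm_num) (by norm_num)
      (by norm_num [cnull]) (by norm_num [cnull]) (Or.inl (by norm_num)) (Or.inr (Or.inl ⟨by norm_num, by norm_num⟩)) (Or.inl (by norm_num)) (by norm_num) (by norm_num) (by norm_num)
      ((TriangleCap.core_ncard_triangles_le_cq3 M hfree hd).trans (by decide))
      (s4_cf16_14 M hfree hcf hd (by omega))
      (s5_cf26_14 M hfree hcf hd (by omega))
      (Or.inl (tail_six_heavy_sq26_14 p hp)) hR hn hfree (level_six_poly_heavy_sq26_14 p hp)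

/-- **The `e`-free core at level `6`, corank `15 ≤ d ≤ 31`, rank `p ≥ 26`** (the cell theorem `c025_core_six_heavy_cell_sq28c` with the per-corank parameters of ArithHeavySq26E … M; circuit bounds: p3's `cq3` table, the 4-circuit table, the crude `C(d + 4, 5)`). -/
theorem c025_core_six_bounded_corank_heavy_sq26_lo (M : Matroid α) [M.Finite] (p d : ℕ) (hp : 26 ≤ p) (hd15 : 15 ≤ d) (hd31 : d ≤ 31)
    (hR : M.eRank = (p : ℕ∞)) (hn : M.E.ncard = p + d)
    (hfree : ∀ e ∈ M.E, ∃ A ⊆ M.E \ {e}, e ∉ M.closure A ∧ e ∉ M.closure ((M.E \ {e}) \ A)) :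
    RLS M p 6 := by
  have hd : M.E.encard = M.eRank + d := by
    rw [hR, ← M.ground_finite.cast_ncard_eq, hn]
    push_cast
    ring
  have hL : ∀ e ∈ M.E, ¬ M.IsLoop e := not_isLoop_of_free M hfree
  have hs : ∀ e ∈ M.E, ∀ f ∈ M.E, e ≠ f → M.eRk {e, f} = 2 := by
    intro e he f hf hef
    have h2 : (2 : ℕ∞) ≤ M.eRk {e, f} :=
      two_le_eRk_of_two_le_ncard_of_free M hfree (pair_subset he hf) (by rw [ncard_pair hef])
    have h3 : M.eRk {e, f} ≤ 2 := by
      have := M.eRk_le_encard {e, f}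
      rwa [encard_pair hef] at this
    exact le_antisymm h3 h2
  have hC1 : ∀ L ⊆ M.E, M.eRk L = 2 → L.ncard ≤ 3 :=
    fun L hL hr => ncard_le_three_of_eRk_two M hs hfree hL hr
  have hC2 : ∀ P ⊆ M.E, M.eRk P ≤ 3 → P.ncard ≤ 6 :=
    fun P hP hr => ncard_le_six_of_eRk_le_three_of_free M hfree hP hr
  interval_cases d
  · exact c025_core_six_heavy_cell_sq28c M p 15 11 1 1 25 19 0 17000 1000 21 7836 662 47
      (by norm_num) (by norm_num) (by norm_num) (by norm_num) (by norm_num) (by norm_num)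
      (by norm_num [cnull]) (by norm_num [cnull]) (Or.inl (by norm_num)) (Or.inr (Or.inl ⟨by norm_num, by norm_num⟩)) (Or.inl (by norm_num)) (by norm_num) (by norm_num) (by norm_num)
      ((TriangleCap.core_ncard_triangles_le_cq3 M hfree hd).trans (by decide))
      ((ncard_fourCircuits_le_avgChain16 15 M hfree hd).trans (by decide))
      ((S1.ncard_fiveCircuits_le_avgChain5b 15 M hfree hd).trans (by decide))
      (Or.inl (tail_six_heavy_sq26_15 p hp)) hR hn hfree (level_six_poly_heavy_sq26_15 p hp)
  · exact c025_core_six_heavy_cell_sq28c M p 16 12 1 1 26 19 0 12161 1000 22 10284 817 54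
      (by norm_num) (by norm_num) (by norm_num) (by norm_num) (by norm_num) (by norm_num)
      (by norm_num [cnull]) (by norm_num [cnull]) (Or.inl (by norm_num)) (Or.inr (Or.inl ⟨by norm_num, by norm_num⟩)) (Or.inl (by norm_num)) (by norm_num) (by norm_num) (by norm_num)
      ((TriangleCap.core_ncard_triangles_le_cq3 M hfree hd).trans (by decide))
      ((ncard_fourCircuits_le_avgChain16 16 M hfree hd).trans (by decide))
      ((S1.ncard_fiveCircuits_le_avgChain5b 16 M hfree hd).trans (by decide))
      (Or.inl (tail_six_heavy_sq26_16 p hp)) hR hn hfree (level_six_poly_heavy_sq26_16 p hp)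
  · exact c025_core_six_heavy_cell_sq28c M p 17 12 1 1 28 19 0 8997 1000 23 13308 998 62
      (by norm_num) (by norm_num) (by norm_num) (by norm_num) (by norm_num) (by norm_num)
      (by norm_num [cnull]) (by norm_num [cnull]) (Or.inl (by norm_num)) (Or.inr (Or.inl ⟨by norm_num, by norm_num⟩)) (Or.inl (by norm_num)) (by norm_num) (by norm_num) (by norm_num)
      ((TriangleCap.core_ncard_triangles_le_cq3 M hfree hd).trans (by decide))
      ((ncard_fourCircuits_le_avgChain16 17 M hfree hd).trans (by decide))
      ((S1.ncard_fiveCircuits_le_avgChain5b 17 M hfree hd).trans (by decide))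
      (Or.inl (tail_six_heavy_sq26_17 p hp)) hR hn hfree (level_six_poly_heavy_sq26_17 p hp)
  · exact c025_core_six_heavy_cell_sq28c M p 18 13 1 1 29 19 0 6862 1000 24 17004 1208 71
      (by norm_num) (by norm_num) (by norm_num) (by norm_num) (by norm_num) (by norm_num)
      (by norm_num [cnull]) (by norm_num [cnull]) (Or.inl (by norm_num)) (Or.inr (Or.inl ⟨by norm_num, by norm_num⟩)) (Or.inl (by norm_num)) (by norm_num) (by norm_num) (by norm_num)
      ((TriangleCap.core_ncard_triangles_le_cq3 M hfree hd).trans (by decide))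
      ((ncard_fourCircuits_le_avgChain16 18 M hfree hd).trans (by decide))
      ((S1.ncard_fiveCircuits_le_avgChain5b 18 M hfree hd).trans (by decide))
      (Or.inl (tail_six_heavy_sq26_18 p hp)) hR hn hfree (level_six_poly_heavy_sq26_18 p hp)
  · exact c025_core_six_heavy_cell_sq28c M p 19 13 1 1 31 19 0 5383 1000 25 21478 1449 81
      (by norm_num) (by norm_num) (by norm_num) (by norm_num) (by norm_num) (by norm_num)
      (by norm_num [cnull]) (by norm_num [cnull]) (Or.inl (by norm_num)) (Or.inr (Or.inl ⟨by norm_num, by norm_num⟩)) (Or.inl (by norm_num)) (by norm_num) (by norm_num) (by norm_num)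
      ((TriangleCap.core_ncard_triangles_le_cq3 M hfree hd).trans (by decide))
      ((ncard_fourCircuits_le_avgChain16 19 M hfree hd).trans (by decide))
      ((S1.ncard_fiveCircuits_le_avgChain5b 19 M hfree hd).trans (by decide))
      (Or.inl (tail_six_heavy_sq26_19 p hp)) hR hn hfree (level_six_poly_heavy_sq26_19 p hp)
  · exact c025_core_six_heavy_cell_sq28c M p 20 14 1 1 32 19 0 4332 1000 26 26847 1725 92
      (by norm_num) (by norm_num) (by norm_num) (by norm_num) (by norm_num) (by norm_num)
      (by norm_num [cnull]) (by norm_num [cnull]) (Or.inl (by norm_num)) (Or.inr (Or.inl ⟨by norm_num, by norm_num⟩)) (Or.inl (by norm_num)) (by norm_num) (by norm_num) (by norm_num)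
      ((TriangleCap.core_ncard_triangles_le_cq3 M hfree hd).trans (by decide))
      ((ncard_fourCircuits_le_avgChain16 20 M hfree hd).trans (by decide))
      ((S1.ncard_fiveCircuits_le_avgChain5b 20 M hfree hd).trans (by decide))
      (Or.inl (tail_six_heavy_sq26_20 p hp)) hR hn hfree (level_six_poly_heavy_sq26_20 p hp)
  · exact c025_core_six_heavy_cell_sq28c M p 21 14 1 1 34 19 0 3569 1000 27 33239 2038 104
      (by norm_num) (by norm_num) (by norm_num) (by norm_num) (by norm_num) (by norm_num)
      (by norm_num [cnull]) (by norm_num [cnull]) (Or.inl (by norm_num)) (Or.inr (Or.inl ⟨by norm_num, by norm_num⟩)) (Or.inl (by norm_num)) (by norm_num) (by norm_num) (by norm_num)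
      ((TriangleCap.core_ncard_triangles_le_cq3 M hfree hd).trans (by decide))
      ((ncard_fourCircuits_le_avgChain16 21 M hfree hd).trans (by decide))
      ((S1.ncard_fiveCircuits_le_avgChain5b 21 M hfree hd).trans (by decide))
      (Or.inl (tail_six_heavy_sq26_21 p hp)) hR hn hfree (level_six_poly_heavy_sq26_21 p hp)
  · exact c025_core_six_heavy_cell_sq28c M p 22 15 1 1 35 0 0 3004 1000 28 40793 2392 117
      (by norm_num) (by norm_num) (by norm_num) (by norm_num) (by norm_num) (by norm_num)
      (by norm_num [cnull]) (by norm_num [cnull]) (Or.inl (by norm_num)) (Or.inr (Or.inr (by norm_num))) (Or.inl (by norm_num)) (by norm_num) (by norm_num) (by norm_num)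
      ((TriangleCap.core_ncard_triangles_le_cq3 M hfree hd).trans (by decide))
      ((ncard_fourCircuits_le_avgChain16 22 M hfree hd).trans (by decide))
      ((S1.ncard_fiveCircuits_le_avgChain5b 22 M hfree hd).trans (by decide))
      (Or.inl (tail_six_heavy_sq26_22 p hp)) hR hn hfree (level_six_poly_heavy_sq26_22 p hp)
  · exact c025_core_six_heavy_cell_sq28c M p 23 17 1 1 35 0 1 2578 1000 29 49661 2790 131
      (by norm_num) (by norm_num) (by norm_num) (by norm_num) (by norm_num) (by norm_num)
      (by norm_num [cnull]) (by norm_num [cnull]) (Or.inl (by norm_num)) (Or.inr (Or.inr (by norm_num))) (Or.inr rfl) (by norm_num) (by norm_num) (by norm_num)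
      ((TriangleCap.core_ncard_triangles_le_cq3 M hfree hd).trans (by decide))
      ((ncard_fourCircuits_le_avgChain16 23 M hfree hd).trans (by decide))
      ((S1.ncard_fiveCircuits_le_avgChain5b 23 M hfree hd).trans (by decide))
      (Or.inl (tail_six_heavy_sq26_23 p hp)) hR hn hfree (level_six_poly_heavy_sq26_23 p hp)
  · exact c025_core_six_heavy_cell_sq28c M p 24 18 1 1 36 0 1 2252 1000 30 60007 3236 146
      (by norm_num) (by norm_num) (by norm_num) (by norm_num) (by norm_num) (by norm_num)
      (by norm_num [cnull]) (by norm_num [cnull]) (Or.inl (by norm_num)) (Or.inr (Or.inr (by norm_num))) (Or.inr rfl) (by norm_num) (by norm_num) (by norm_num)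
      ((TriangleCap.core_ncard_triangles_le_cq3 M hfree hd).trans (by decide))
      ((ncard_fourCircuits_le_avgChain16 24 M hfree hd).trans (by decide))
      ((S1.ncard_fiveCircuits_le_avgChain5b 24 M hfree hd).trans (by decide))
      (Or.inl (tail_six_heavy_sq26_24 p hp)) hR hn hfree (level_six_poly_heavy_sq26_24 p hp)
  · exact c025_core_six_heavy_cell_sq28c M p 25 19 1 1 37 0 1 1999 1000 31 72008 3733 162
      (by norm_num) (by norm_num) (by norm_num) (by norm_num) (by norm_num) (by norm_num)
      (by norm_num [cnull]) (by norm_num [cnull]) (Or.inl (by norm_num)) (Or.inr (Or.inr (by norm_num))) (Or.inr rfl) (by norm_num) (by norm_num) (by norm_num)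
      ((TriangleCap.core_ncard_triangles_le_cq3 M hfree hd).trans (by decide))
      ((ncard_fourCircuits_le_avgChain16 25 M hfree hd).trans (by decide))
      ((S1.ncard_fiveCircuits_le_avgChain5b 25 M hfree hd).trans (by decide))
      (Or.inl (tail_six_heavy_sq26_25 p hp)) hR hn hfree (level_six_poly_heavy_sq26_25 p hp)
  · exact c025_core_six_heavy_cell_sq28c M p 26 21 1 1 32 0 1 1801 1000 32 85855 4286 179
      (by norm_num) (by norm_num) (by norm_num) (by norm_num) (by norm_num) (by norm_num)
      (by norm_num [cnull]) (by norm_num [cnull]) (Or.inr ⟨by norm_num, by norm_num⟩) (Or.inr (Or.inr (by norm_num))) (Or.inr rfl) (by norm_num) (by norm_num) (by norm_num)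
      ((TriangleCap.core_ncard_triangles_le_cq3 M hfree hd).trans (by decide))
      ((ncard_fourCircuits_le_avgChain16 26 M hfree hd).trans (by decide))
      ((S1.ncard_fiveCircuits_le_avgChain5b 26 M hfree hd).trans (by decide))
      (Or.inl (tail_six_heavy_sq26_26 p hp)) hR hn hfree (level_six_poly_heavy_sq26_26 p hp)
  · exact c025_core_six_heavy_cell_sq28c M p 27 21 1 1 33 0 1 1644 1000 33 101754 4898 197
      (by norm_num) (by norm_num) (by norm_num) (by norm_num) (by norm_num) (by norm_num)
      (by norm_num [cnull]) (by norm_num [cnull]) (Or.inr ⟨by norm_num, by norm_num⟩) (Or.inr (Or.inr (by norm_num))) (Or.inr rfl) (by norm_num) (by norm_num) (by norm_num)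
      ((TriangleCap.core_ncard_triangles_le_cq3 M hfree hd).trans (by decide))
      ((ncard_fourCircuits_le_avgChain16 27 M hfree hd).trans (by decide))
      ((S1.ncard_fiveCircuits_le_avgChain5b 27 M hfree hd).trans (by decide))
      (Or.inl (tail_six_heavy_sq26_27 p hp)) hR hn hfree (level_six_poly_heavy_sq26_27 p hp)
  · exact c025_core_six_heavy_cell_sq28c M p 28 22 1 1 34 0 1 1519 1000 34 119924 5573 216
      (by norm_num) (by norm_num) (by norm_num) (by norm_num) (by norm_num) (by norm_num)
      (by norm_num [cnull]) (by norm_num [cnull]) (Or.inr ⟨by norm_num, by norm_num⟩) (Or.inr (Or.inr (by norm_num))) (Or.inr rfl) (by norm_num) (by norm_num) (by norm_num)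
      ((TriangleCap.core_ncard_triangles_le_cq3 M hfree hd).trans (by decide))
      ((ncard_fourCircuits_le_avgChain16 28 M hfree hd).trans (by decide))
      ((S1.ncard_fiveCircuits_le_avgChain5b 28 M hfree hd).trans (by decide))
      (Or.inl (tail_six_heavy_sq26_28 p hp)) hR hn hfree (level_six_poly_heavy_sq26_28 p hp)
  · exact c025_core_six_heavy_cell_sq28c M p 29 22 1 1 35 0 1 1418 1000 35 140600 6316 236
      (by norm_num) (by norm_num) (by norm_num) (by norm_num) (by norm_num) (by norm_num)
      (by norm_num [cnull]) (by norm_num [cnull]) (Or.inr ⟨by norm_num, by norm_num⟩) (Or.inr (Or.inr (by norm_num))) (Or.inr rfl) (by norm_num) (by norm_num) (by norm_num)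
      ((TriangleCap.core_ncard_triangles_le_cq3 M hfree hd).trans (by decide))
      ((ncard_fourCircuits_le_avgChain16 29 M hfree hd).trans (by decide))
      ((S1.ncard_fiveCircuits_le_avgChain5b 29 M hfree hd).trans (by decide))
      (Or.inl (tail_six_heavy_sq26_29 p hp)) hR hn hfree (level_six_poly_heavy_sq26_29 p hp)
  · exact c025_core_six_heavy_cell_sq28c M p 30 23 1 1 36 0 1 1337 1000 36 164033 7130 408
      (by norm_num) (by norm_num) (by norm_num) (by norm_num) (by norm_num) (by norm_num)
      (by norm_num [cnull]) (by norm_num [cnull]) (Or.inr ⟨by norm_num, by norm_num⟩) (Or.inr (Or.inr (by norm_num))) (Or.inr rfl) (by norm_num) (by norm_num) (by norm_num)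
      ((S1.ncard_triangles_le_of_nullity_sharp M hC1 hC2 (by omega) hd).trans (by norm_num))
      ((ncard_fourCircuits_le_avgChain16 30 M hfree hd).trans (by decide))
      ((S1.ncard_fiveCircuits_le_avgChain5b 30 M hfree hd).trans (by decide))
      (Or.inl (tail_six_heavy_sq26_30 p hp)) hR hn hfree (level_six_poly_heavy_sq26_30 p hp)
  · exact c025_core_six_heavy_cell_sq28c M p 31 23 1 1 37 0 1 1271 1000 37 190489 8021 437
      (by norm_num) (by norm_num) (by norm_num) (by norm_num) (by norm_num) (by norm_num)
      (by norm_num [cnull]) (by norm_num [cnull]) (Or.inr ⟨by norm_num, by norm_num⟩) (Or.inr (Or.inr (by norm_num))) (Or.inr rfl) (by norm_num) (by norm_num) (by norm_num)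
      ((S1.ncard_triangles_le_of_nullity_sharp M hC1 hC2 (by omega) hd).trans (by norm_num))
      ((ncard_fourCircuits_le_avgChain16 31 M hfree hd).trans (by decide))
      ((S1.ncard_fiveCircuits_le_avgChain5b 31 M hfree hd).trans (by decide))
      (Or.inl (tail_six_heavy_sq26_31 p hp)) hR hn hfree (level_six_poly_heavy_sq26_31 p hp)
end ThmN

end PercRepro
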